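import Literature.Probability.Percolation.HarrisTheorem
import HarnessLib

/-!
# Thin blocked square annuli `{n ≤ ‖z‖_∞ ≤ n + t}` (RSW blocking at aspect ratio `2`)

Topic: Probability / Percolation (bond percolation on `ℤ²`). `HarrisTheorem.lean` implements
Bollobás–Riordan's blocked square annulus `{n ≤ ‖z‖_∞ ≤ 3n}` (*Percolation* (2006), Ch. 3,
proof of Thm. 6, event `E_k`): four `6n × 2n` rectangles none of which is crossed the short way,
so that open paths from `B(n)` cannot leave `(-3n, 3n)²`. For annulus-crossing bounds at
*every* ratio `≥ 2` of Euclidean radii (Bollobás–Riordan 2006, Ch. 7, Lemma 4; the tree's named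
fact `Literature.Probability.Percolation.annulusOpenCrossing_half_le`) the square annulus of ratio `3` is too thick
(`3√2 > 2`); this file runs the same construction with a **thickness parameter** `t`:

* `thinAnnulusBlocked n t`: none of the four rectangles `[-(n+t), n+t] × [n, n+t]` (top),
  `[-(n+t), n+t] × [-(n+t), -n]` (bottom), `[-(n+t), -n] × [-(n+t), n+t]` (left),
  `[n, n+t] × [-(n+t), n+t]` (right), of dimensions `2(n+t) × t`, has an open crossing the short
  way (`thinTopShortCrossing`, …); `annulusBlocked n` is the case `t = 2n` up to the harmless
  overlap conventions;
* `openConnIn_box_of_thinAnnulusBlocked`: a blocked thin annulus confines open paths from `B(n)`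
  to the open box `(-(n+t), n+t)²` (same first-exit argument as
  `openConnIn_box_of_annulusBlocked`);
* locality (`determinedBy_thinAnnulusBlocked`: bonds of `{n ≤ ‖z‖_∞ ≤ n + t}`) and
  measurability;
* the four short-way crossing probabilities equal `crossingProb p t (2(n+t))`
  (`real_thinTopShortCrossing`, …), whence by Harris's lemma
  `P_p(thinAnnulusBlocked n t) ≥ (1 - crossingProb p t (2(n+t)))⁴`
  (`pow_four_le_real_thinAnnulusBlocked`), and at `p = 1/2`, by duality and the RSW lower bound
  at aspect ratio `8` (`rsw_lowerBound_holds`), a uniform lower bound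
  `P_{1/2}(thinAnnulusBlocked n ⌊3n/8⌋) ≥ ε > 0` for `n ≥ 32`
  (`exists_pos_le_real_thinAnnulusBlocked_half`).

Everything is proved; this is groundwork for discharging `annulusOpenCrossing_half_le`.

## References
* B. Bollobás, O. Riordan, *Percolation*, CUP (2006), Ch. 3 (proof of Thm. 6), Ch. 7 Lemma 4.
* G. Grimmett, *Percolation*, 2nd ed. (1999), §11.7–11.8.
-/

namespace Literature.Probability.Percolation

open MeasureTheory SimpleGraph

noncomputable section

/-! ### The thin square annulus `{n ≤ ‖z‖_∞ ≤ n + t}` as four rectangles -/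

/-- Lower-left corner `(-(n+t), n)` of the top rectangle `[-(n+t), n+t] × [n, n+t]`. [folklore] -/
def thinTopCorner (n t : ℕ) : LatticeModels.Site 2 := ![-(n + t : ℤ), n]

/-- Lower-left corner `(-(n+t), -(n+t))` of the bottom rectangle `[-(n+t), n+t] × [-(n+t), -n]`
and of the left rectangle `[-(n+t), -n] × [-(n+t), n+t]`. [folklore] -/
def thinBottomCorner (n t : ℕ) : LatticeModels.Site 2 := ![-(n + t : ℤ), -(n + t : ℤ)]

/-- Lower-left corner `(n, -(n+t))` of the right rectangle `[n, n+t] × [-(n+t), n+t]`. [folklore] -/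
def thinRightCorner (n t : ℕ) : LatticeModels.Site 2 := ![(n : ℤ), -(n + t : ℤ)]

/-- First coordinate of `thinTopCorner`. [folklore] -/
@[simp] theorem thinTopCorner_apply_zero (n t : ℕ) : thinTopCorner n t 0 = -(n + t : ℤ) := rfl

/-- Second coordinate of `thinTopCorner`. [folklore] -/
@[simp] theorem thinTopCorner_apply_one (n t : ℕ) : thinTopCorner n t 1 = n := rfl

/-- First coordinate of `thinBottomCorner`. [folklore] -/
@[simp] theorem thinBottomCorner_apply_zero (n t : ℕ) : thinBottomCorner n t 0 = -(n + t : ℤ) := rfl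

/-- Second coordinate of `thinBottomCorner`. [folklore] -/
@[simp] theorem thinBottomCorner_apply_one (n t : ℕ) : thinBottomCorner n t 1 = -(n + t : ℤ) := rfl

/-- First coordinate of `thinRightCorner`. [folklore] -/
@[simp] theorem thinRightCorner_apply_zero (n t : ℕ) : thinRightCorner n t 0 = n := rfl

/-- Second coordinate of `thinRightCorner`. [folklore] -/
@[simp] theorem thinRightCorner_apply_one (n t : ℕ) : thinRightCorner n t 1 = -(n + t : ℤ) := rfl

/-- The top rectangle `[-(n+t), n+t] × [n, n+t]` has an open top–bottom (short-way) crossing.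
(Bollobás–Riordan 2006, Ch. 3, proof of Thm. 6, with thickness `t` in place of `2n`.)
[cite: BollobasRiordan2006, Ch. 3, proof of Thm. 6 (Figure 8)] -/
def thinTopShortCrossing (n t : ℕ) : Set (BondConfig (LatticeModels.Site 2)) :=
  openCrossing ((· + thinTopCorner n t) '' ↑(rectangle (2 * (n + t)) t))
    ((· + thinTopCorner n t) '' ↑(bottomSide (2 * (n + t)) t))
    ((· + thinTopCorner n t) '' ↑(topSide (2 * (n + t)) t))

/-- The bottom rectangle `[-(n+t), n+t] × [-(n+t), -n]` has an open top–bottom crossing.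
[cite: BollobasRiordan2006, Ch. 3, proof of Thm. 6 (Figure 8)] -/
def thinBottomShortCrossing (n t : ℕ) : Set (BondConfig (LatticeModels.Site 2)) :=
  openCrossing ((· + thinBottomCorner n t) '' ↑(rectangle (2 * (n + t)) t))
    ((· + thinBottomCorner n t) '' ↑(bottomSide (2 * (n + t)) t))
    ((· + thinBottomCorner n t) '' ↑(topSide (2 * (n + t)) t))

/-- The left rectangle `[-(n+t), -n] × [-(n+t), n+t]` has an open left–right crossing.
[cite: BollobasRiordan2006, Ch. 3, proof of Thm. 6 (Figure 8)] -/
def thinLeftShortCrossing (n t : ℕ) : Set (BondConfig (LatticeModels.Site 2)) :=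
  openCrossing ((· + thinBottomCorner n t) '' ↑(rectangle t (2 * (n + t))))
    ((· + thinBottomCorner n t) '' ↑(leftSide t (2 * (n + t))))
    ((· + thinBottomCorner n t) '' ↑(rightSide t (2 * (n + t))))

/-- The right rectangle `[n, n+t] × [-(n+t), n+t]` has an open left–right crossing.
[cite: BollobasRiordan2006, Ch. 3, proof of Thm. 6 (Figure 8)] -/
def thinRightShortCrossing (n t : ℕ) : Set (BondConfig (LatticeModels.Site 2)) :=
  openCrossing ((· + thinRightCorner n t) '' ↑(rectangle t (2 * (n + t))))
    ((· + thinRightCorner n t) '' ↑(leftSide t (2 * (n + t))))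
    ((· + thinRightCorner n t) '' ↑(rightSide t (2 * (n + t))))

/-- **The thin annulus `{n ≤ ‖z‖_∞ ≤ n + t}` is blocked**: none of its four rectangles has an
open short-way crossing (by rectangle duality, each dual rectangle is crossed the long way by an
open dual path, and their union contains an open dual circuit in the annulus). A decreasing
event. (Bollobás–Riordan 2006, Ch. 3, proof of Thm. 6, event `E_k`, with thickness `t`.)
[cite: BollobasRiordan2006, Ch. 3, proof of Thm. 6 (event E_k)] -/
def thinAnnulusBlocked (n t : ℕ) : Set (BondConfig (LatticeModels.Site 2)) :=
  (thinTopShortCrossing n t)ᶜ ∩ (thinBottomShortCrossing n t)ᶜ ∩ (thinLeftShortCrossing n t)ᶜ ∩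
    (thinRightShortCrossing n t)ᶜ

/-! ### A blocked thin annulus confines open paths from its inside -/

/-- The first vertex of an open path from the open box `(-m, m)²` outside it lies on the boundary
of `B(m)`, and the path up to it runs inside `B(m)`. [folklore] -/
theorem exists_exit_box' {ω : BondConfig (LatticeModels.Site 2)} (hω : ω ⊆ (LatticeModels.zdGraph 2).edgeSet) {m : ℕ}
    {x y : LatticeModels.Site 2} (hx : ∀ i, -(m : ℤ) < x i ∧ x i < m)
    (hy : ¬ ∀ i, -(m : ℤ) < y i ∧ y i < m) (h : ω ∈ openConnIn Set.univ x y) :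
    ∃ w : LatticeModels.Site 2, (w 0 = m ∨ w 0 = -(m : ℤ) ∨ w 1 = m ∨ w 1 = -(m : ℤ)) ∧
      ω ∈ openConnIn (↑(LatticeModels.box 2 m)) x w := by
  obtain ⟨u, w, hu, hw, -, huw, hne, hr⟩ :=
    exists_openConnIn_exit (T := {z : LatticeModels.Site 2 | ∀ i, -(m : ℤ) < z i ∧ z i < m}) hx hy h
  have hadj : (LatticeModels.zdGraph 2).Adj u w := by
    have := hω huw
    rwa [SimpleGraph.mem_edgeSet] at this
  simp only [Set.mem_setOf_eq, Fin.forall_fin_two, not_and_or, not_lt] at hu hw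
  rw [zdGraph_two_adj_iff] at hadj
  have hwbox : w ∈ (↑(LatticeModels.box 2 m) : Set (LatticeModels.Site 2)) := by
    rw [Finset.mem_coe, LatticeModels.mem_box, Fin.forall_fin_two]
    omega
  refine ⟨w, by omega, ?_⟩
  have hsub : (Set.univ ∩ {z : LatticeModels.Site 2 | ∀ i, -(m : ℤ) < z i ∧ z i < m}) ⊆
      (↑(LatticeModels.box 2 m) : Set (LatticeModels.Site 2)) := by
    intro z hz
    rw [Finset.mem_coe, LatticeModels.mem_box]
    exact fun i => ⟨(hz.2 i).1.le, (hz.2 i).2.le⟩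
  have hubox : u ∈ (↑(LatticeModels.box 2 m) : Set (LatticeModels.Site 2)) := by
    rw [Finset.mem_coe, LatticeModels.mem_box, Fin.forall_fin_two]
    omega
  exact PlanarDuality.openConnIn_trans (openConnIn_mono hsub x u hr) (openConnIn_of_adj hubox hwbox huw hne)

/-- **A blocked thin annulus confines open paths**: for a lattice configuration in
`thinAnnulusBlocked n t`, `t ≥ 1`, every open path starting in `B(n)` stays in the open box
`(-(n+t), n+t)²` (stop the path at its first vertex with `‖w‖_∞ = n + t`; the piece after its
last visit to the row/column at level `n` is a short-way crossing of one of the four rectangles).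
(Bollobás–Riordan 2006, Ch. 3, proof of Thm. 6, with thickness `t`.)
[cite: BollobasRiordan2006, Ch. 3, proof of Thm. 6] -/
theorem openConnIn_box_of_thinAnnulusBlocked {ω : BondConfig (LatticeModels.Site 2)}
    (hω : ω ⊆ (LatticeModels.zdGraph 2).edgeSet) {n t : ℕ} (ht : 1 ≤ t) (hB : ω ∈ thinAnnulusBlocked n t)
    {x y : LatticeModels.Site 2} (hx : x ∈ LatticeModels.box 2 n) (h : ω ∈ openConnIn Set.univ x y) :
    ∀ i, -(n + t : ℤ) < y i ∧ y i < n + t := by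
  by_contra hy
  rw [LatticeModels.mem_box, Fin.forall_fin_two] at hx
  have hx' : ∀ i, -((n + t : ℕ) : ℤ) < x i ∧ x i < (n + t : ℕ) := by
    rw [Fin.forall_fin_two]; push_cast; omega
  have hy' : ¬ ∀ i, -((n + t : ℕ) : ℤ) < y i ∧ y i < (n + t : ℕ) := by
    push_cast; exact hy
  obtain ⟨w, hw, hr⟩ := exists_exit_box' hω hx' hy' h
  have hr' := hr
  obtain ⟨-, hwbox, -⟩ := hr'
  rw [Finset.mem_coe, LatticeModels.mem_box, Fin.forall_fin_two] at hwbox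
  push_cast at hw hwbox
  rw [openConnIn_comm] at hr
  obtain ⟨⟨⟨hT, hBo⟩, hL⟩, hR⟩ := hB
  rcases hw with hw0 | hw0 | hw1 | hw1
  · -- right side: `w₀ = n + t`
    refine hR ?_
    unfold thinRightShortCrossing
    rw [openCrossing_comm]
    refine openCrossing_of_exit hω (T := {z : LatticeModels.Site 2 | (n : ℤ) < z 0})
      (by simp only [Set.mem_setOf_eq]; omega) (by simp only [Set.mem_setOf_eq]; omega) hr ?_ ?_ ?_
    · rintro z ⟨hz, hzT⟩
      rw [Finset.mem_coe, LatticeModels.mem_box, Fin.forall_fin_two] at hz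
      simp only [Set.mem_setOf_eq] at hzT
      rw [mem_image_add_rectangle, thinRightCorner_apply_zero, thinRightCorner_apply_one]
      push_cast at hz ⊢; omega
    · rw [mem_image_add_rightSide, thinRightCorner_apply_zero, thinRightCorner_apply_one]
      push_cast; omega
    · intro a b ha haT hb hbT hadj
      rw [Finset.mem_coe, LatticeModels.mem_box, Fin.forall_fin_two] at ha hb
      simp only [Set.mem_setOf_eq, not_lt] at haT hbT
      rw [zdGraph_two_adj_iff] at hadj
      rw [mem_image_add_rectangle, mem_image_add_leftSide, thinRightCorner_apply_zero,
        thinRightCorner_apply_one]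
      push_cast at ha hb ⊢; omega
  · -- left side: `w₀ = -(n + t)`
    refine hL ?_
    unfold thinLeftShortCrossing
    refine openCrossing_of_exit hω (T := {z : LatticeModels.Site 2 | z 0 < -(n : ℤ)})
      (by simp only [Set.mem_setOf_eq]; omega) (by simp only [Set.mem_setOf_eq]; omega) hr ?_ ?_ ?_
    · rintro z ⟨hz, hzT⟩
      rw [Finset.mem_coe, LatticeModels.mem_box, Fin.forall_fin_two] at hz
      simp only [Set.mem_setOf_eq] at hzT
      rw [mem_image_add_rectangle, thinBottomCorner_apply_zero, thinBottomCorner_apply_one]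
      push_cast at hz ⊢; omega
    · rw [mem_image_add_leftSide, thinBottomCorner_apply_zero, thinBottomCorner_apply_one]
      push_cast; omega
    · intro a b ha haT hb hbT hadj
      rw [Finset.mem_coe, LatticeModels.mem_box, Fin.forall_fin_two] at ha hb
      simp only [Set.mem_setOf_eq, not_lt] at haT hbT
      rw [zdGraph_two_adj_iff] at hadj
      rw [mem_image_add_rectangle, mem_image_add_rightSide, thinBottomCorner_apply_zero,
        thinBottomCorner_apply_one]
      push_cast at ha hb ⊢; omega
  · -- top side: `w₁ = n + t`
    refine hT ?_
    unfold thinTopShortCrossing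
    rw [openCrossing_comm]
    refine openCrossing_of_exit hω (T := {z : LatticeModels.Site 2 | (n : ℤ) < z 1})
      (by simp only [Set.mem_setOf_eq]; omega) (by simp only [Set.mem_setOf_eq]; omega) hr ?_ ?_ ?_
    · rintro z ⟨hz, hzT⟩
      rw [Finset.mem_coe, LatticeModels.mem_box, Fin.forall_fin_two] at hz
      simp only [Set.mem_setOf_eq] at hzT
      rw [mem_image_add_rectangle, thinTopCorner_apply_zero, thinTopCorner_apply_one]
      push_cast at hz ⊢; omega
    · rw [mem_image_add_topSide, thinTopCorner_apply_zero, thinTopCorner_apply_one]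
      push_cast; omega
    · intro a b ha haT hb hbT hadj
      rw [Finset.mem_coe, LatticeModels.mem_box, Fin.forall_fin_two] at ha hb
      simp only [Set.mem_setOf_eq, not_lt] at haT hbT
      rw [zdGraph_two_adj_iff] at hadj
      rw [mem_image_add_rectangle, mem_image_add_bottomSide, thinTopCorner_apply_zero,
        thinTopCorner_apply_one]
      push_cast at ha hb ⊢; omega
  · -- bottom side: `w₁ = -(n + t)`
    refine hBo ?_
    unfold thinBottomShortCrossing
    refine openCrossing_of_exit hω (T := {z : LatticeModels.Site 2 | z 1 < -(n : ℤ)})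
      (by simp only [Set.mem_setOf_eq]; omega) (by simp only [Set.mem_setOf_eq]; omega) hr ?_ ?_ ?_
    · rintro z ⟨hz, hzT⟩
      rw [Finset.mem_coe, LatticeModels.mem_box, Fin.forall_fin_two] at hz
      simp only [Set.mem_setOf_eq] at hzT
      rw [mem_image_add_rectangle, thinBottomCorner_apply_zero, thinBottomCorner_apply_one]
      push_cast at hz ⊢; omega
    · rw [mem_image_add_bottomSide, thinBottomCorner_apply_zero, thinBottomCorner_apply_one]
      push_cast; omega
    · intro a b ha haT hb hbT hadj
      rw [Finset.mem_coe, LatticeModels.mem_box, Fin.forall_fin_two] at ha hb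
      simp only [Set.mem_setOf_eq, not_lt] at haT hbT
      rw [zdGraph_two_adj_iff] at hadj
      rw [mem_image_add_rectangle, mem_image_add_topSide, thinBottomCorner_apply_zero,
        thinBottomCorner_apply_one]
      push_cast at ha hb ⊢; omega

/-! ### Locality and measurability -/

/-- `thinAnnulusBlocked n t` is measurable. [folklore] -/
theorem measurableSet_thinAnnulusBlocked (n t : ℕ) : MeasurableSet (thinAnnulusBlocked n t) :=
  ((((measurableSet_openCrossing_image _ _ _ _).compl.inter
    (measurableSet_openCrossing_image _ _ _ _).compl).inter
    (measurableSet_openCrossing_image _ _ _ _).compl).inter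
    (measurableSet_openCrossing_image _ _ _ _).compl)

/-- The complement of the open crossing event of a translated rectangle lying in the thin annulus
`box (n+t) \ box (n-1) = {n ≤ ‖z‖_∞ ≤ n+t}` depends only on the pairs of sites of that annulus.
[folklore] -/
theorem determinedBy_compl_openCrossing_image_of_subset' {n t : ℕ} {F : Finset (LatticeModels.Site 2)}
    {v : LatticeModels.Site 2} (A B : Set (LatticeModels.Site 2)) (hF : ∀ z ∈ F, z + v ∈ LatticeModels.annulus 2 (n - 1) (n + t)) :
    DeterminedBy (openCrossing ((· + v) '' (↑F : Set (LatticeModels.Site 2))) A B)ᶜ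
      ↑((LatticeModels.annulus 2 (n - 1) (n + t)).sym2) := by
  have hsub : (↑(F.image (· + v)).sym2 : Set (Sym2 (LatticeModels.Site 2))) ⊆
      ↑((LatticeModels.annulus 2 (n - 1) (n + t)).sym2) := by
    refine Finset.coe_subset.2 (Finset.sym2_mono fun z hz => ?_)
    obtain ⟨w, hw, rfl⟩ := Finset.mem_image.1 hz
    exact hF w hw
  have h := (determinedBy_openCrossing_image F v A B).mono hsub
  rw [determinedBy_iff] at h ⊢
  intro ω ω' hω
  rw [Set.mem_compl_iff, Set.mem_compl_iff, h ω ω' hω]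

/-- **`thinAnnulusBlocked n t` depends only on the bonds of the annulus `{n ≤ ‖z‖_∞ ≤ n + t}`**
(`= box (n+t) \ box (n-1)`), `n ≥ 1`. [cite: BollobasRiordan2006, Ch. 3, proof of Thm. 6] -/
theorem determinedBy_thinAnnulusBlocked {n t : ℕ} (hn : 1 ≤ n) :
    DeterminedBy (thinAnnulusBlocked n t) ↑((LatticeModels.annulus 2 (n - 1) (n + t)).sym2) := by
  unfold thinAnnulusBlocked thinTopShortCrossing thinBottomShortCrossing thinLeftShortCrossing
    thinRightShortCrossing
  refine (((determinedBy_compl_openCrossing_image_of_subset' _ _ ?_).inter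
    (determinedBy_compl_openCrossing_image_of_subset' _ _ ?_)).inter
    (determinedBy_compl_openCrossing_image_of_subset' _ _ ?_)).inter
    (determinedBy_compl_openCrossing_image_of_subset' _ _ ?_)
  all_goals
    intro z hz
    rw [mem_rectangle_iff] at hz
    simp only [LatticeModels.mem_annulus, LatticeModels.mem_box, Fin.forall_fin_two, Pi.add_apply, thinTopCorner_apply_zero,
      thinTopCorner_apply_one, thinBottomCorner_apply_zero, thinBottomCorner_apply_one,
      thinRightCorner_apply_zero, thinRightCorner_apply_one]
    push_cast at hz ⊢
    omega

/-- The complement of `thinAnnulusBlocked n t` depends only on the bonds of the annulus.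
[folklore] -/
theorem determinedBy_compl_thinAnnulusBlocked {n t : ℕ} (hn : 1 ≤ n) :
    DeterminedBy (thinAnnulusBlocked n t)ᶜ ↑((LatticeModels.annulus 2 (n - 1) (n + t)).sym2) := by
  have h := determinedBy_thinAnnulusBlocked (t := t) hn
  rw [determinedBy_iff] at h ⊢
  intro ω ω' hω
  rw [Set.mem_compl_iff, Set.mem_compl_iff, h ω ω' hω]

/-! ### Probabilities of the four crossing events -/

/-- `P_p(top rectangle crossed top–bottom) = crossingProb p t (2(n+t))`. [folklore] -/
theorem real_thinTopShortCrossing (p : unitInterval) (n t : ℕ) :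
    (bondPercolation (LatticeModels.zdGraph 2) p).real (thinTopShortCrossing n t) =
      crossingProb p t (2 * (n + t)) := by
  rw [thinTopShortCrossing, real_openCrossing_shift, ← tbCrossing, real_tbCrossing]

/-- `P_p(bottom rectangle crossed top–bottom) = crossingProb p t (2(n+t))`. [folklore] -/
theorem real_thinBottomShortCrossing (p : unitInterval) (n t : ℕ) :
    (bondPercolation (LatticeModels.zdGraph 2) p).real (thinBottomShortCrossing n t) =
      crossingProb p t (2 * (n + t)) := by
  rw [thinBottomShortCrossing, real_openCrossing_shift, ← tbCrossing, real_tbCrossing]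

/-- `P_p(left rectangle crossed left–right) = crossingProb p t (2(n+t))`. [folklore] -/
theorem real_thinLeftShortCrossing (p : unitInterval) (n t : ℕ) :
    (bondPercolation (LatticeModels.zdGraph 2) p).real (thinLeftShortCrossing n t) =
      crossingProb p t (2 * (n + t)) := by
  rw [thinLeftShortCrossing, real_openCrossing_shift]
  rfl

/-- `P_p(right rectangle crossed left–right) = crossingProb p t (2(n+t))`. [folklore] -/
theorem real_thinRightShortCrossing (p : unitInterval) (n t : ℕ) :
    (bondPercolation (LatticeModels.zdGraph 2) p).real (thinRightShortCrossing n t) =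
      crossingProb p t (2 * (n + t)) := by
  rw [thinRightShortCrossing, real_openCrossing_shift]
  rfl

/-! ### Doubling families of thin annuli: locality and disjointness -/

/-- Pairs of sites of `box 2 m` and of the annulus `box 2 M \\ box 2 (n - 1)` are disjoint when
`m < n`. [folklore] -/
theorem disjoint_sym2_box_sym2_annulus' {m n M : ℕ} (h : m < n) :
    Disjoint (↑((LatticeModels.box 2 m).sym2) : Set (Sym2 (LatticeModels.Site 2))) ↑((LatticeModels.annulus 2 (n - 1) M).sym2) := by
  rw [Finset.disjoint_coe, Finset.disjoint_left]
  intro e he he'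
  induction e using Sym2.ind with
  | h x y =>
    rw [Finset.mk_mem_sym2_iff] at he he'
    obtain ⟨hx, -⟩ := he
    obtain ⟨hx', -⟩ := he'
    rw [LatticeModels.mem_annulus] at hx'
    refine hx'.2 ?_
    rw [LatticeModels.mem_box] at hx ⊢
    intro i
    have := hx i
    omega

/-- The scales of the doubling family: `n_j = n₀ 2^j`, thickness `t_j = ⌊3 n_j / 8⌋`; consecutive
annuli `{n_j ≤ ‖z‖_∞ ≤ n_j + t_j}` are disjoint since `n_j + t_j < 2 n_j = n_{j+1}`. The events
"none of the first `K` annuli is blocked" depend only on the bonds of `box (n₀ 2^K - 1)`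
(for `n₀ ≥ 2`). [cite: BollobasRiordan2006, Ch. 3, proof of Thm. 6] -/
theorem determinedBy_iInter_compl_thinAnnulusBlocked {n₀ : ℕ} (hn₀ : 2 ≤ n₀) (K : ℕ) :
    DeterminedBy (⋂ j ∈ Finset.range K,
        (thinAnnulusBlocked (n₀ * 2 ^ j) (3 * (n₀ * 2 ^ j) / 8))ᶜ)
      ↑((LatticeModels.box 2 (n₀ * 2 ^ K - 1)).sym2) := by
  induction K with
  | zero => simpa using determinedBy_univ _
  | succ K ih =>
    rw [Finset.range_add_one, Finset.set_biInter_insert]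
    have hnK : 1 ≤ n₀ * 2 ^ K := Nat.one_le_iff_ne_zero.2 (by positivity)
    refine DeterminedBy.inter
      ((determinedBy_compl_thinAnnulusBlocked (t := 3 * (n₀ * 2 ^ K) / 8) hnK).mono ?_) (ih.mono ?_)
    · refine Finset.coe_subset.2 (Finset.sym2_mono fun z hz => ?_)
      rw [LatticeModels.mem_annulus] at hz
      have hz1 := hz.1
      rw [LatticeModels.mem_box] at hz1 ⊢
      intro i
      have := hz1 i
      have hK2 : 2 ≤ n₀ * 2 ^ K := le_trans hn₀ (Nat.le_mul_of_pos_right _ (by positivity))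
      have h8 : n₀ * 2 ^ K + 3 * (n₀ * 2 ^ K) / 8 ≤ n₀ * 2 ^ (K + 1) - 1 := by
        rw [show n₀ * 2 ^ (K + 1) = 2 * (n₀ * 2 ^ K) by ring]; omega
      have h8' : ((n₀ * 2 ^ K : ℕ) : ℤ) + ((3 * (n₀ * 2 ^ K) / 8 : ℕ) : ℤ) ≤
          ((n₀ * 2 ^ (K + 1) - 1 : ℕ) : ℤ) := by exact_mod_cast h8
      push_cast at this h8' ⊢
      omega
    · refine Finset.coe_subset.2 (Finset.sym2_mono fun z hz => ?_)
      rw [LatticeModels.mem_box] at hz ⊢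
      intro i
      have := hz i
      have hle : n₀ * 2 ^ K - 1 ≤ n₀ * 2 ^ (K + 1) - 1 := by
        rw [show n₀ * 2 ^ (K + 1) = 2 * (n₀ * 2 ^ K) by ring]; omega
      have hle' : ((n₀ * 2 ^ K - 1 : ℕ) : ℤ) ≤ ((n₀ * 2 ^ (K + 1) - 1 : ℕ) : ℤ) := by
        exact_mod_cast hle
      omega

/-- The events of the doubling family form measurable events. [folklore] -/
theorem measurableSet_iInter_compl_thinAnnulusBlocked (n₀ K : ℕ) :
    MeasurableSet (⋂ j ∈ Finset.range K,
      (thinAnnulusBlocked (n₀ * 2 ^ j) (3 * (n₀ * 2 ^ j) / 8))ᶜ) :=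
  Finset.measurableSet_biInter _ fun _ _ => (measurableSet_thinAnnulusBlocked _ _).compl


end

end Literature.Probability.Percolation

namespace Literature.Probability.Percolation

open MeasureTheory LatticeModels PlanarDuality

noncomputable section

/-- **Harris's Lemma applied to the four rectangles**:
`P_p(thinAnnulusBlocked n t) ≥ (1 - crossingProb p t (2(n+t)))⁴` (`harris_fkg_lower`, three
times). (Bollobás–Riordan 2006, Ch. 3, proof of Thm. 6.) [cite: BollobasRiordan2006, Ch. 3, proof of Thm. 6] -/
theorem pow_four_le_real_thinAnnulusBlocked (p : unitInterval) (n t : ℕ) :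
    (1 - crossingProb p t (2 * (n + t))) ^ 4 ≤
      (bondPercolation (zdGraph 2) p).real (thinAnnulusBlocked n t) := by
  set μ := bondPercolation (zdGraph 2) p with hμ
  have mT : MeasurableSet (thinTopShortCrossing n t) := measurableSet_openCrossing_image _ _ _ _
  have mB : MeasurableSet (thinBottomShortCrossing n t) := measurableSet_openCrossing_image _ _ _ _
  have mL : MeasurableSet (thinLeftShortCrossing n t) := measurableSet_openCrossing_image _ _ _ _
  have mR : MeasurableSet (thinRightShortCrossing n t) := measurableSet_openCrossing_image _ _ _ _
  have hT : μ.real (thinTopShortCrossing n t)ᶜ = 1 - crossingProb p t (2 * (n + t)) := by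
    rw [probReal_compl_eq_one_sub mT, real_thinTopShortCrossing]
  have hB : μ.real (thinBottomShortCrossing n t)ᶜ = 1 - crossingProb p t (2 * (n + t)) := by
    rw [probReal_compl_eq_one_sub mB, real_thinBottomShortCrossing]
  have hL : μ.real (thinLeftShortCrossing n t)ᶜ = 1 - crossingProb p t (2 * (n + t)) := by
    rw [probReal_compl_eq_one_sub mL, real_thinLeftShortCrossing]
  have hR : μ.real (thinRightShortCrossing n t)ᶜ = 1 - crossingProb p t (2 * (n + t)) := by
    rw [probReal_compl_eq_one_sub mR, real_thinRightShortCrossing]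
  have lT : IsLowerSet (thinTopShortCrossing n t)ᶜ := (isUpperSet_openCrossing _ _ _).compl
  have lB : IsLowerSet (thinBottomShortCrossing n t)ᶜ := (isUpperSet_openCrossing _ _ _).compl
  have lL : IsLowerSet (thinLeftShortCrossing n t)ᶜ := (isUpperSet_openCrossing _ _ _).compl
  have lR : IsLowerSet (thinRightShortCrossing n t)ᶜ := (isUpperSet_openCrossing _ _ _).compl
  have h1 := harris_fkg_lower (zdGraph 2) p lT lB mT.compl mB.compl
  have h2 := harris_fkg_lower (zdGraph 2) p (lT.inter lB) lL (mT.compl.inter mB.compl) mL.compl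
  have h3 := harris_fkg_lower (zdGraph 2) p ((lT.inter lB).inter lL) lR
    ((mT.compl.inter mB.compl).inter mL.compl) mR.compl
  calc (1 - crossingProb p t (2 * (n + t))) ^ 4
      = μ.real (thinTopShortCrossing n t)ᶜ * μ.real (thinBottomShortCrossing n t)ᶜ *
          μ.real (thinLeftShortCrossing n t)ᶜ * μ.real (thinRightShortCrossing n t)ᶜ := by
        rw [hT, hB, hL, hR]; ring
    _ ≤ μ.real ((thinTopShortCrossing n t)ᶜ ∩ (thinBottomShortCrossing n t)ᶜ) *
          μ.real (thinLeftShortCrossing n t)ᶜ * μ.real (thinRightShortCrossing n t)ᶜ :=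
        mul_le_mul_of_nonneg_right (mul_le_mul_of_nonneg_right h1 measureReal_nonneg)
          measureReal_nonneg
    _ ≤ μ.real ((thinTopShortCrossing n t)ᶜ ∩ (thinBottomShortCrossing n t)ᶜ ∩
          (thinLeftShortCrossing n t)ᶜ) * μ.real (thinRightShortCrossing n t)ᶜ :=
        mul_le_mul_of_nonneg_right h2 measureReal_nonneg
    _ ≤ μ.real (thinAnnulusBlocked n t) := h3

/-- **Uniform blocking probability at `p = 1/2` for thickness `⌊3n/8⌋`**: there is `ε > 0` with
`P_{1/2}(thinAnnulusBlocked n (3n/8)) ≥ ε` for all `n ≥ 32`. By duality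
(`crossingProb_add_crossingProb_symm`, Bollobás–Riordan 2006, Ch. 3, Cor. 3(i)),
`1 - crossingProb ½ t (2(n+t)) = crossingProb ½ (2(n+t)+1) (t-1)`, which for `t = ⌊3n/8⌋`,
`n ≥ 32` (so that `2(n+t)+1 ≤ 8t-1`) is at least the RSW constant at aspect ratio `8`
(`rsw_lowerBound_holds`, Ch. 3, eq. (3)); then `ε = c⁴` by `pow_four_le_real_thinAnnulusBlocked`.
[cite: BollobasRiordan2006, Ch. 3, eq. (3) and proof of Thm. 6] -/
theorem exists_pos_le_real_thinAnnulusBlocked_half :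
    ∃ ε : ℝ, 0 < ε ∧ ∀ n : ℕ, 32 ≤ n →
      ε ≤ (bondPercolation (zdGraph 2) half).real (thinAnnulusBlocked n (3 * n / 8)) := by
  obtain ⟨c, hc, hcn⟩ := rsw_lowerBound_holds 8 (by norm_num)
  refine ⟨c ^ 4, by positivity, fun n hn => ?_⟩
  set t := 3 * n / 8 with ht
  have ht1 : 1 ≤ t := by omega
  have hlen : 2 * (n + t) + 1 ≤ 8 * t - 1 := by omega
  have hdual := crossingProb_add_crossingProb_symm_holds half (t - 1) (2 * (n + t))
  rw [symm_half, Nat.sub_add_cancel ht1] at hdual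
  have hct : c ≤ 1 - crossingProb half t (2 * (n + t)) := by
    have h' : 1 - crossingProb half t (2 * (n + t)) = crossingProb half (2 * (n + t) + 1) (t - 1) := by
      linarith
    rw [h']
    exact (hcn t ht1).trans (crossingProb_anti_left half hlen _)
  exact (pow_le_pow_left₀ hc.le hct 4).trans (pow_four_le_real_thinAnnulusBlocked half n t)

/-- **Independence of the doubling family of thin annuli** (Bollobás–Riordan 2006, Ch. 3, proof
of Thm. 6: "As the `A_k` are disjoint, the events `E_k` are independent"): for `n₀ ≥ 2`,
`P_p(none of the first K annuli is blocked) = ∏_{j<K} (1 - P_p(thinAnnulusBlocked n_j t_j))`.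
[cite: BollobasRiordan2006, Ch. 3, proof of Thm. 6] -/
theorem real_iInter_compl_thinAnnulusBlocked (p : unitInterval) {n₀ : ℕ} (hn₀ : 2 ≤ n₀) (K : ℕ) :
    (bondPercolation (zdGraph 2) p).real (⋂ j ∈ Finset.range K,
        (thinAnnulusBlocked (n₀ * 2 ^ j) (3 * (n₀ * 2 ^ j) / 8))ᶜ) =
      ∏ j ∈ Finset.range K,
        (1 - (bondPercolation (zdGraph 2) p).real
          (thinAnnulusBlocked (n₀ * 2 ^ j) (3 * (n₀ * 2 ^ j) / 8))) := by
  induction K with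
  | zero => simp
  | succ K ih =>
    rw [Finset.prod_range_succ, Finset.range_add_one, Finset.set_biInter_insert, ← ih,
      ← probReal_compl_eq_one_sub (measurableSet_thinAnnulusBlocked _ _), Set.inter_comm]
    have hnK : 1 ≤ n₀ * 2 ^ K := Nat.one_le_iff_ne_zero.2 (by positivity)
    have hlt : n₀ * 2 ^ K - 1 < n₀ * 2 ^ K := by omega
    exact bondPercolation_real_inter_of_disjoint (zdGraph 2) p (disjoint_sym2_box_sym2_annulus' hlt)
      (determinedBy_iInter_compl_thinAnnulusBlocked hn₀ K)
      (determinedBy_compl_thinAnnulusBlocked hnK)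
      (measurableSet_iInter_compl_thinAnnulusBlocked n₀ K)
      (measurableSet_thinAnnulusBlocked _ _).compl

/-- **Geometric decay over the doubling family at `p = 1/2`**: for `n₀ ≥ 32`,
`P_{1/2}(none of the first K annuli is blocked) ≤ (1 - ε)^K` with a uniform blocking
probability `ε` as in `exists_pos_le_real_thinAnnulusBlocked_half`. (Bollobás–Riordan 2006,
Ch. 3, proof of Thm. 6; Grimmett 1999, (11.102).) [cite: BollobasRiordan2006, Ch. 3, proof of Thm. 6] -/
theorem real_iInter_compl_thinAnnulusBlocked_half_le {ε : ℝ}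
    (hε : ∀ n : ℕ, 32 ≤ n →
      ε ≤ (bondPercolation (zdGraph 2) half).real (thinAnnulusBlocked n (3 * n / 8)))
    {n₀ : ℕ} (hn₀ : 32 ≤ n₀) (K : ℕ) :
    (bondPercolation (zdGraph 2) half).real (⋂ j ∈ Finset.range K,
        (thinAnnulusBlocked (n₀ * 2 ^ j) (3 * (n₀ * 2 ^ j) / 8))ᶜ) ≤ (1 - ε) ^ K := by
  rw [real_iInter_compl_thinAnnulusBlocked half (by omega) K]
  calc ∏ j ∈ Finset.range K, (1 - (bondPercolation (zdGraph 2) half).real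
          (thinAnnulusBlocked (n₀ * 2 ^ j) (3 * (n₀ * 2 ^ j) / 8)))
      ≤ ∏ _j ∈ Finset.range K, (1 - ε) := by
        refine Finset.prod_le_prod (fun _ _ => ?_) (fun j _ => ?_)
        · rw [sub_nonneg]; exact measureReal_le_one
        · have : 32 ≤ n₀ * 2 ^ j := le_trans hn₀ (Nat.le_mul_of_pos_right _ (by positivity))
          linarith [hε _ this]
    _ = (1 - ε) ^ K := by rw [Finset.prod_const, Finset.card_range]

end

end Literature.Probability.Percolation
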